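import Summits.QuantumFields.GaugeBoot.PlanarCertificateSoundnessZd
import HarnessLib

/-!
# A worked planar certificate in the tree's format: `W(plaquette) ≤ 1` from one Gram block and three identification rows, replayed on every state (gauge-boot, large-`N` supplement 8 — sanity instance)

HONEST FRAMING (cell `pub-gaugeboot`, page 1 of every file): the venture produces certified bounds
on lattice expectations at stated coupling, gauge group, dimension and torus size; NOT a mass gap,
NOT a continuum limit, NOT a string tension; NOT large `N` unless marked CONDITIONAL; NOT
Yang–Mills-summit-bearing (barriers `FixedCouplingUltralocality`, `PerturbativeInvisibility`).
A TOY instance exercising the definitions of `PlanarCertificateSoundnessZd`; the bound it certifies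
(`W ≤ 1`) is trivial and is NOT a result of the cell.

## Content

Kazakov–Zheng's first example (arXiv:2203.11360 §3.1: the `2 × 2` correlation matrix of the paths
`[]` and `P` gives `u_P² ≤ 1`) in the tree's certificate format: for a plaquette word `P` at the base
point, the certificate `plaquetteLeOneCert a ν` has no loop-equation rows, no relaxation block, two
identical rank-one Gram blocks on the closed words `([], P)` with factor `(½, −½)`, and three
identification rows `W([]) − 1`, `W(P⁻¹) − W(P)`, `W(P⁻¹·P) − W([])` with multipliers
`(−1, ½, −½)`; objective `W(P)`, bound `1`.

* `plaquetteLeOneCert_isValid` — the certificate identity `1 − W(P) = rhs(W, Q)` holds for ALL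
  planar data (`ring`): the format's `IsValid` is what a checker verifies;
* `lin_plaquetteLeOneCert_loopData` — the three identification rows hold on the data of EVERY
  probability measure on `ℤ^d` configurations (normalisation `t_{[]} = 1` for `N ≥ 1`; reversal
  `t_{P⁻¹} = conj t_P`; backtracking `hol(P⁻¹·P) = 1`);
* `loopW_plaquette_le_one_of_cert` — the transfer theorem `PlanarCertificate.obj_loopW_le` then
  returns `W_μ(P) ≤ 1` for every such state (any compact `G`, continuous `ρ`, `N ≥ 1`), with zero
  defect (no rows, no relaxation block) — an end-to-end replay of a (trivial) planar certificate.

[folklore]; the example is Kazakov–Zheng's (§3.1, "which gives `u_P² ≤ 1`, obvious from unitarity").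
-/

noncomputable section

open MeasureTheory
open scoped BigOperators
open Literature.Probability.LatticeModels (Site)
open Literature.MathematicalPhysics.QuantumLattice

namespace Summit.QuantumFields.GaugeBoot

variable {d N : ℕ}

/-- **The toy certificate "`W(P) ≤ 1`"** for the plaquette word `P = plaqWord a ν true`: two rank-one
Gram blocks on `([], P)` with factor `(½, −½)`, identification rows `W([]) − 1`, `W(P⁻¹) − W(P)`,
`W(P⁻¹·P) − W([])` with multipliers `(−1, ½, −½)`, no loop-equation rows, no relaxation block.
[cite: KazakovZheng2023, §3.1] -/
def plaquetteLeOneCert (a ν : Fin d) : PlanarCertificate d where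
  βt := 0
  nR := 0
  rowAxis := Fin.elim0
  rowWord := Fin.elim0
  rowMult := Fin.elim0
  nJ := 2
  gramSize := fun _ => 2
  gramWord := fun _ => ![[], plaqWord a ν true]
  gramVec := fun _ => ![1 / 2, -1 / 2]
  nI := 0
  shorLoop := Fin.elim0
  nS := 0
  shorConst := Fin.elim0
  shorVec := Fin.elim0
  nE := 3
  lin := ![fun W _ => W [] - 1, fun W _ => W (plaqWord a ν true).reverse - W (plaqWord a ν true),
    fun W _ => W ((plaqWord a ν true).reverse ++ plaqWord a ν true) - W []]
  linMult := ![-1, 1 / 2, -1 / 2]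
  obj := fun W => W (plaqWord a ν true)
  bound := 1

/-- **The certificate identity holds for all planar data** (what a checker verifies):
`1 − W(P) = Σ_j ⟨c cᵀ, Gram_j(W)⟩ + Σ_e z_e lin_e(W)`. [folklore] -/
theorem plaquetteLeOneCert_isValid (a ν : Fin d) : (plaquetteLeOneCert a ν).IsValid := by
  intro W Q
  unfold PlanarCertificate.rhs PlanarCertificate.shorTerm gramPairing plaquetteLeOneCert
  simp only [Fin.sum_univ_two, Fin.sum_univ_three, Finset.univ_eq_empty, Finset.sum_empty, Matrix.cons_val_zero,
    Matrix.cons_val_one, Matrix.cons_val_two, Matrix.head_cons, Matrix.tail_cons, Word.reverse_nil, List.nil_append,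
    List.append_nil]
  ring

section States

variable {G : Type*} [Group G] [TopologicalSpace G] [IsTopologicalGroup G] [CompactSpace G]
  [MeasurableSpace G] [BorelSpace G] (ρ : G →* Matrix (Fin N) (Fin N) ℂ)

omit [TopologicalSpace G] [IsTopologicalGroup G] [CompactSpace G] [BorelSpace G] in
/-- Normalisation: `W([]) = 1` for a probability measure and `N ≥ 1`. [folklore] -/
theorem loopW_nil (μ : Measure (LGConfig d G)) [IsProbabilityMeasure μ] (hN : 1 ≤ N) (x : Site d) :
    loopW ρ μ x [] = 1 := by
  have hN' : (N : ℂ) ≠ 0 := by exact_mod_cast Nat.one_le_iff_ne_zero.1 hN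
  simp [loopW, loopTrZd_nil, div_self hN']

omit [BorelSpace G] in
/-- Reversal: `W(C⁻¹) = W(C)` for a closed word and any finite measure. [folklore] -/
theorem loopW_reverse (hρ : Continuous ρ) (μ : Measure (LGConfig d G)) (x : Site d) {C : Word d}
    (hC : Word.endpointZd x C = x) : loopW ρ μ x C.reverse = loopW ρ μ x C := by
  simp only [loopW, loopTrZd_reverse ρ hρ x hC, integral_conj, Complex.conj_re]

omit [TopologicalSpace G] [IsTopologicalGroup G] [CompactSpace G] [BorelSpace G] in
/-- Backtracking: `W(C⁻¹ · C) = W([])` for a closed word and any measure. [folklore] -/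
theorem loopW_reverse_append_self (μ : Measure (LGConfig d G)) (x : Site d) {C : Word d} (hC : Word.endpointZd x C = x) :
    loopW ρ μ x (C.reverse ++ C) = loopW ρ μ x [] := by
  have h : ∀ U : LGConfig d G, wordHolonomyZd U x (C.reverse ++ C) = wordHolonomyZd U x [] := fun U => by
    have hr := wordHolonomyZd_reverse U x C
    rw [hC] at hr
    have he : Word.endpointZd x C.reverse = x := by
      have := Word.endpointZd_reverse x C
      rwa [hC] at this
    rw [wordHolonomyZd_append, he, hr, inv_mul_cancel, wordHolonomyZd_nil]
  simp only [loopW, loopTrZd_apply, h]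

omit [BorelSpace G] in
/-- **The identification rows of the toy certificate hold on every probability state** (`N ≥ 1`). [folklore] -/
theorem lin_plaquetteLeOneCert_loopData (hρ : Continuous ρ) (μ : Measure (LGConfig d G)) [IsProbabilityMeasure μ]
    (hN : 1 ≤ N) (x : Site d) (a ν : Fin d) (e : Fin 3) :
    (plaquetteLeOneCert a ν).lin e (loopW ρ μ x) (loopQ ρ μ x) = 0 := by
  have hP : Word.endpointZd x (plaqWord a ν true) = x := by
    rw [← TiltedRP.endpoint_zdUnit, TiltedRP.endpoint_plaqWord]
  fin_cases e
  · show loopW ρ μ x [] - 1 = 0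
    rw [loopW_nil ρ μ hN x, sub_self]
  · show loopW ρ μ x (plaqWord a ν true).reverse - loopW ρ μ x (plaqWord a ν true) = 0
    rw [loopW_reverse ρ hρ μ x hP, sub_self]
  · show loopW ρ μ x ((plaqWord a ν true).reverse ++ plaqWord a ν true) - loopW ρ μ x [] = 0
    rw [loopW_reverse_append_self ρ μ x hP, sub_self]

/-- ★ **End-to-end replay of the toy certificate**: for every probability measure on `ℤ^d`
configurations (compact `G`, continuous `N`-dimensional `ρ`, `N ≥ 1`) the transfer theorem returns
`W_μ(P) ≤ 1` with zero defect. (Trivial as a bound — `abs_loopW_le_one` — the point is the pipeline.)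
[folklore] -/
theorem loopW_plaquette_le_one_of_cert (hρ : Continuous ρ) (μ : Measure (LGConfig d G)) [IsProbabilityMeasure μ]
    (hN : 1 ≤ N) (x : Site d) (a ν : Fin d) :
    loopW ρ μ x (plaqWord a ν true) ≤ 1 := by
  have hP : Word.endpointZd x (plaqWord a ν true) = x := by
    rw [← TiltedRP.endpoint_zdUnit, TiltedRP.endpoint_plaqWord]
  have hgram : ∀ (j : Fin (plaquetteLeOneCert a ν).nJ) (i : Fin ((plaquetteLeOneCert a ν).gramSize j)),
      Word.endpointZd x ((plaquetteLeOneCert a ν).gramWord j i) = x := by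
    intro j i
    change Word.endpointZd x ((![[], plaqWord a ν true] : Fin 2 → Word d) i) = x
    fin_cases i
    · rfl
    · exact hP
  have h := (plaquetteLeOneCert a ν).obj_loopW_le ρ (plaquetteLeOneCert_isValid a ν) hρ μ x hgram Fin.elim0
    (fun r => Fin.elim0 r) (lin_plaquetteLeOneCert_loopData ρ hρ μ hN x a ν)
  simp only [plaquetteLeOneCert, Finset.univ_eq_empty, Finset.sum_empty, add_zero] at h ⊢
  exact h

end States

end Summit.QuantumFields.GaugeBoot

end
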